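import Literature.AlgebraicGeometry.Resolution.SeparablyClosedDensity
import Literature.AlgebraicGeometry.Resolution.HenselizedRationalArtinSchreier
import Mathlib.FieldTheory.Perfect
import Mathlib.Data.Nat.Factorization.Basic
import HarnessLib

/-!
# Elimination of the monomials of `p`-divisible index modulo `℘(F)` (Kuhlmann 2019, Lemma 4.2, first half)

Topic: `Literature/AlgebraicGeometry/Resolution` (valued function fields). First PROVED half
of the hypothesis `(H42)` of `Kuhlmann2019DegreePStepAssembly.lean` = the part of F.-V.
Kuhlmann, *Elimination of ramification II: Henselian rationality*, Israel J. Math. 234 (2019)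
= arXiv:1701.05508, **Lemma 4.2** (the Artin–Schreier normal form in equal characteristic)
used in the proof of Prop. 4.8. Its printed proof (p. 8):

> Set `deg f = n`. We consider the following Taylor expansion with variables `X` and `X₀`:
> (4.7) `f(X) = ∑ᵢ fᵢ(X₀)(X − X₀)ⁱ` where `fᵢ` denotes the `i`-th formal derivative of `f`.
> For any `i` which is divisible by `p`, say `i = pj`, the summand `f_{pj}(X₀)(X − X₀)^{pj}`
> [is congruent modulo `℘` to `f_{pj}(X₀)^{1/p}(X − X₀)^j`]. By a repeated application of this
> procedure we find that modulo `℘(K′[X, X₀])`, (4.8)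
> `f(X) ≡ f(X₀) + ∑'_j (f_j(X₀) + ∑_{ν(j)} f_{jp^ν}(X₀)^{1/p^ν})(X − X₀)^j`, where `∑'_j`
> denotes the sum over all `j ≤ n` with `(p, j) = 1`, and `∑_{ν(j)}` the sum over all `ν ≥ 1`
> with `jp^ν ≤ n`. … It remains to prove the last assertion for separably tame `(K, v)`. By
> [17, Corollary 3.12], such `(K, v)` lies dense in its perfect hull … We choose
> `a′_0, …, a′_n ∈ K` such that the values `v(aᵢ − a′ᵢ)` are sufficiently large … hence w.l.o.g.
> we may assume that `g` has coefficients in `K`.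

Over a SEPARABLY CLOSED `K` (the case of Prop. 5.2) the two steps can be merged and carried
out inside any henselian `F ⊇ K(z̃)` — here `F = K(x)^h` — without the purely inseparable
extension `K′`: for `i = jp^ν` and `βᵢ ∈ K` close to `bᵢ^{1/p^ν}` (density of `K` in its
perfect hull, `SeparablyClosedDensity.lean`),

  `bᵢ z̃^i − βᵢ z̃^j = ((βᵢ z̃^j)^{p^ν} − βᵢ z̃^j) + (bᵢ − βᵢ^{p^ν}) z̃^i ∈ ℘(F) + 𝓜_F ⊆ ℘(F)`

(`𝓜_F ⊆ ℘(F)` by Hensel's Lemma). This file PROVES the resulting elimination statement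
`exists_pElimination`, keeping track of the VALUES of the new coefficients through the exact
coefficients `S_j = ∑_ν b_{jp^ν}^{1/p^ν}` of (4.8) (`pRootSum`), whose `p^D`-th powers are
polynomial in the `bᵢ` (`pRootSum_pow`, the device (4.9) of the source) — the input of the
second half (the choice of the centre `c` and the scale `d` by the transcendental approximation
type, (4.10)–(4.11)).

## Content

* `posIndices`, `pFreePart`, `pFiber`, `pFreeIndices`, `pRootSum` — bookkeeping DEFINITIONS
  (indices `1..D`, the `p`-free part of an index, its fibres, the indices prime to `p`, the
  exact coefficients), with unfolding API.
* `exists_pElimination` — **the elimination modulo `℘(F)`**, PROVED.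

## Sources

* [K19] F.-V. Kuhlmann, Israel J. Math. 234 (2019) = arXiv:1701.05508: Lemma 4.2 and its proof
  ((4.7)–(4.9)), p. 8. [Kuhlmann2019]

## Rendering notes

As in `Kuhlmann2019DegreePStepAssembly.lean`: `(Ω, V)` one valued field of characteristic `p`
(here with `Ω` perfect, e.g. algebraically closed, so that `p^ν`-th roots are the inverse
iterated Frobenius), subfields `K ≤ F ≤ Ω`, polynomials over `K` = polynomials over `Ω` with
coefficients in `K`, `℘(F) = {d^p − d : d ∈ F}` elementwise, values multiplicative.
-/

noncomputable section

namespace Literature.AlgebraicGeometry.Resolution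

universe u

open Polynomial IsLocalRing

variable {Ω : Type u} [Field Ω] (V : ValuationSubring Ω)

/-! ### The `p`-free part of an index, fibres, and the exact coefficients -/

section Defs

variable (p : ℕ)

/-- The positive indices `1, …, D`. [folklore] -/
def posIndices (D : ℕ) : Finset ℕ := (Finset.range (D + 1)).filter fun i => 0 < i

/-- The `p`-free part `j = i / p^{ν_p(i)}` of an index `i` ("`i = j p^ν` with `(p, j) = 1`",
Kuhlmann 2019, proof of Lemma 4.2). [cite: Kuhlmann2019, Lemma 4.2 (proof)] -/
def pFreePart (i : ℕ) : ℕ := i / p ^ i.factorization p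

/-- The indices `i ∈ {1, …, D}` with `p`-free part `j`: the fibre `{j, jp, jp², …} ∩ [1, D]`
over which the proof of Lemma 4.2 collects the monomials `c_{jp^ν} X^{jp^ν}` ("`∑_{ν(j)}`
denotes the sum over all `ν ≥ 1` with `jp^ν ≤ n`"). [cite: Kuhlmann2019, Lemma 4.2 (proof)] -/
def pFiber (D j : ℕ) : Finset ℕ := (posIndices D).filter fun i => pFreePart p i = j

/-- The indices `j ∈ {1, …, D}` prime to `p` ("`∑_{j}'` denotes the sum over all `j ≤ n` with
`(p, j) = 1`"). [cite: Kuhlmann2019, Lemma 4.2 (proof)] -/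
def pFreeIndices (D : ℕ) : Finset ℕ := (Finset.range (D + 1)).filter fun j => 0 < j ∧ ¬ p ∣ j

variable [Fact p.Prime] [CharP Ω p] [PerfectRing Ω p]

/-- The **exact coefficient** of `X^j` after elimination of the `p`-divisible indices of a
polynomial `B` of degree `≤ D` inside the perfect hull: `∑_{ν : jp^ν ≤ D} b_{jp^ν}^{1/p^ν}`
(Kuhlmann 2019, proof of Lemma 4.2, (4.8): the coefficient `f_j(X₀) + ∑_{ν(j)} f_{jp^ν}(X₀)^{1/p^ν}`).
The `p^ν`-th roots are taken with the inverse iterated Frobenius of the perfect field `Ω`.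
[cite: Kuhlmann2019, Lemma 4.2 (proof, (4.8))] -/
def pRootSum (B : Polynomial Ω) (D j : ℕ) : Ω :=
  ∑ i ∈ pFiber p D j, (iterateFrobeniusEquiv Ω p (i.factorization p)).symm (B.coeff i)

end Defs

/-! ### API -/

section API

variable {p : ℕ}

omit V in
/-- Membership in `posIndices`. [folklore] -/
theorem mem_posIndices_iff {D i : ℕ} : i ∈ posIndices D ↔ 0 < i ∧ i ≤ D := by
  unfold posIndices
  rw [Finset.mem_filter, Finset.mem_range]
  omega

omit V in
/-- Membership in a fibre. [folklore] -/
theorem mem_pFiber_iff {D j i : ℕ} : i ∈ pFiber p D j ↔ (0 < i ∧ i ≤ D) ∧ pFreePart p i = j := by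
  unfold pFiber
  rw [Finset.mem_filter, mem_posIndices_iff]

omit V in
/-- Membership in `pFreeIndices`. [folklore] -/
theorem mem_pFreeIndices_iff {D j : ℕ} : j ∈ pFreeIndices p D ↔ (0 < j ∧ j ≤ D) ∧ ¬ p ∣ j := by
  unfold pFreeIndices
  rw [Finset.mem_filter, Finset.mem_range]
  constructor
  · rintro ⟨h1, h2, h3⟩; exact ⟨⟨h2, by omega⟩, h3⟩
  · rintro ⟨⟨h1, h2⟩, h3⟩; exact ⟨by omega, h1, h3⟩

omit V in
/-- `i = p^{ν_p(i)} · pFreePart p i`. [folklore] -/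
theorem pow_factorization_mul_pFreePart (i : ℕ) :
    p ^ i.factorization p * pFreePart p i = i := by
  unfold pFreePart
  exact Nat.ordProj_mul_ordCompl_eq_self i p

omit V in
/-- The `p`-free part of a positive index is positive, prime to `p`, and at most the index.
[folklore] -/
theorem pFreePart_pos_and_not_dvd_and_le (hp : p.Prime) {i : ℕ} (hi : 0 < i) :
    0 < pFreePart p i ∧ ¬ p ∣ pFreePart p i ∧ pFreePart p i ≤ i := by
  refine ⟨?_, ?_, ?_⟩
  · exact Nat.ordCompl_pos p hi.ne'
  · exact Nat.not_dvd_ordCompl hp hi.ne'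
  · exact Nat.div_le_self _ _

omit V in
/-- The `p`-free part of a positive index `≤ D` lies in `pFreeIndices p D`. [folklore] -/
theorem pFreePart_mem_pFreeIndices (hp : p.Prime) {D i : ℕ} (hi : i ∈ posIndices D) :
    pFreePart p i ∈ pFreeIndices p D := by
  rw [mem_posIndices_iff] at hi
  obtain ⟨h1, h2, h3⟩ := pFreePart_pos_and_not_dvd_and_le hp hi.1
  exact mem_pFreeIndices_iff.mpr ⟨⟨h1, h3.trans hi.2⟩, h2⟩

omit V in
/-- `ν_p(i) ≤ i` for `i > 0` (indeed `p^{ν_p(i)} ≤ i`). [folklore] -/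
theorem factorization_le_of_pos (hp : p.Prime) {i : ℕ} (hi : 0 < i) : i.factorization p ≤ i := by
  have h1 : p ^ i.factorization p ≤ i := Nat.ordProj_le p hi.ne'
  have h2 : i.factorization p < p ^ i.factorization p := Nat.lt_pow_self hp.one_lt
  omega

omit V in
/-- The fibre of `j > D` is empty. [folklore] -/
theorem pFiber_eq_empty_of_lt (hp : p.Prime) {D j : ℕ} (hj : D < j) : pFiber p D j = ∅ := by
  refine Finset.eq_empty_of_forall_notMem fun i hi => ?_
  obtain ⟨⟨hi0, hiD⟩, hij⟩ := mem_pFiber_iff.mp hi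
  have := (pFreePart_pos_and_not_dvd_and_le hp hi0).2.2
  omega

variable [Fact p.Prime] [CharP Ω p] [PerfectRing Ω p]

omit V in
/-- `(b^{1/p^ν})^{p^ν} = b` for the inverse iterated Frobenius. [folklore] -/
theorem iterateFrobeniusEquiv_symm_pow (ν : ℕ) (b : Ω) :
    ((iterateFrobeniusEquiv Ω p ν).symm b) ^ p ^ ν = b := by
  rw [← iterateFrobeniusEquiv_def, RingEquiv.apply_symm_apply]

omit V in
/-- The exact coefficient of `j > D` vanishes. [folklore] -/
theorem pRootSum_eq_zero_of_lt {B : Polynomial Ω} {D j : ℕ} (hj : D < j) : pRootSum p B D j = 0 := by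
  unfold pRootSum
  rw [pFiber_eq_empty_of_lt (Fact.out : p.Prime) hj, Finset.sum_empty]

omit V in
/-- `(pRootSum)^{p^D} = ∑_{i ∈ fibre} b_i^{p^{D − ν_p(i)}}` — the `p^λ`-th power of the exact
coefficient is a polynomial expression in the coefficients (Kuhlmann 2019, (4.9): "For large
enough `λ ∈ ℕ`, the power (4.9) is a polynomial in `X₀`"). [cite: Kuhlmann2019, Lemma 4.2 (proof, (4.9))] -/
theorem pRootSum_pow (B : Polynomial Ω) (D j : ℕ) :
    pRootSum p B D j ^ p ^ D = ∑ i ∈ pFiber p D j, B.coeff i ^ p ^ (D - i.factorization p) := by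
  have hp : p.Prime := Fact.out
  unfold pRootSum
  rw [← iterateFrobenius_def, map_sum]
  refine Finset.sum_congr rfl fun i hi => ?_
  obtain ⟨⟨hi0, hiD⟩, -⟩ := mem_pFiber_iff.mp hi
  have hν : i.factorization p ≤ D := (factorization_le_of_pos hp hi0).trans hiD
  rw [iterateFrobenius_def]
  conv_lhs => rw [← Nat.add_sub_cancel' hν, pow_add, pow_mul, iterateFrobeniusEquiv_symm_pow]

end API

/-! ### The elimination -/

section Elimination

variable {p : ℕ} [Fact p.Prime] [CharP Ω p] [PerfectRing Ω p]

/-- **Elimination of the `p`-divisible indices modulo `℘(F)`** (Kuhlmann 2019, proof of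
Lemma 4.2: "For any `i` which is divisible by `p`, say `i = pj`, the summand … [is replaced
using `b^p ≡ b` modulo `℘`] … By a repeated application of this procedure we find that modulo
`℘(K′[X, X₀])` … (4.8)", followed by "We choose `a′_0, …, a′_n ∈ K` such that the values
`v(aᵢ − a′ᵢ)` are sufficiently large"), carried out INSIDE a henselian field `F` over a
separably closed `K`, so that no purely inseparable extension `K′` is needed. Let `(Ω, V)` be
a valued field of characteristic `p` with `Ω` perfect, `K ≤ F ≤ Ω` subfields with `K`
separably closed and non-trivially valued and `V ∩ F` henselian (Hensel's Lemma), `z̃ ∈ F` with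
`v(z̃) ≤ 1`, and `B` a polynomial over `K` of degree `≤ D`. Then there is a polynomial `g` over
`K` with

* `B(z̃) − g(z̃) ∈ ℘(F) = {d^p − d : d ∈ F}`;
* `g` has the constant term of `B` and NO monomial of positive index divisible by `p`;
* for `0 < j`, `p ∤ j`, the coefficient `g_j ∈ K` is `0` if the exact coefficient
  `S_j = ∑_ν b_{jp^ν}^{1/p^ν}` (`pRootSum`) vanishes, and has the value of `S_j` otherwise.

PROOF. For `i = jp^ν > 0` choose `βᵢ ∈ K` with `v(βᵢ − bᵢ^{1/p^ν}) < 1` (`K` is dense in its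
perfect hull, `SeparablyClosedDensity.lean`); then
`bᵢ z̃^i − βᵢ z̃^j = ((βᵢz̃^j)^{p^ν} − βᵢz̃^j) + (bᵢ − βᵢ^{p^ν}) z̃^i ∈ ℘(F) + 𝓜_F ⊆ ℘(F)`
(`𝓜_F ⊆ ℘(F)` by Hensel's Lemma, `exists_artinSchreierRoot_of_valuation_lt_one`). Collecting the
`βᵢ` along the fibres `{j, jp, jp², …}` and replacing `∑_ν β_{jp^ν}` by an approximant
`g_j ∈ K` of `S_j` (again by density; `g_j = 0` if `S_j = 0`, `v(g_j − S_j) < min(1, v(S_j))`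
otherwise, a `K`-element of value `v(S_j)` existing because `vK` is divisible,
`exists_valuation_pow_eq_of_isSepClosed`) changes the sum by an element of `𝓜_F ⊆ ℘(F)`.
[cite: Kuhlmann2019, Lemma 4.2 (proof)] -/
theorem exists_pElimination {K F : Subfield Ω} [IsSepClosed K] (hKF : K ≤ F)
    (hnt : ∃ π ∈ K, π ≠ 0 ∧ V.valuation π < 1)
    (hF : HenselianLocalRing (V.comap (algebraMap F Ω)))
    {zt : Ω} (hztF : zt ∈ F) (hzt : V.valuation zt ≤ 1)
    {B : Polynomial Ω} (hB : ∀ k, B.coeff k ∈ K) {D : ℕ} (hD : B.natDegree ≤ D) :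
    ∃ g : Polynomial Ω, (∀ k, g.coeff k ∈ K) ∧ g.coeff 0 = B.coeff 0 ∧
      (∃ d ∈ F, B.eval zt - g.eval zt = d ^ p - d) ∧
      (∀ i, 0 < i → p ∣ i → g.coeff i = 0) ∧
      (∀ j, 0 < j → ¬ p ∣ j → (pRootSum p B D j = 0 → g.coeff j = 0) ∧
        (pRootSum p B D j ≠ 0 → V.valuation (g.coeff j) = V.valuation (pRootSum p B D j))) := by
  classical
  have hp : p.Prime := Fact.out
  obtain ⟨π, hπK, hπ0, hπ1⟩ := hnt
  have hexp : ringExpChar Ω = p := ringExpChar.eq Ω p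
  have hztpow : ∀ k : ℕ, V.valuation (zt ^ k) ≤ 1 := fun k => by
    rw [map_pow]; exact pow_le_one₀ zero_le hzt
  -- notation
  set ν : ℕ → ℕ := fun i => i.factorization p with hνdef
  set jj : ℕ → ℕ := fun i => pFreePart p i with hjjdef
  set r : ℕ → Ω := fun i => (iterateFrobeniusEquiv Ω p (ν i)).symm (B.coeff i) with hrdef
  have hr : ∀ i, r i ^ p ^ ν i = B.coeff i := fun i => iterateFrobeniusEquiv_symm_pow (ν i) _
  have hdecomp : ∀ i, p ^ ν i * jj i = i := fun i => pow_factorization_mul_pFreePart i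
  ---------------------------------------------------------------- Step 1: `βᵢ ∈ K` near `rᵢ`
  have hβ : ∀ i, ∃ β ∈ K, V.valuation (r i - β) < 1 := by
    intro i
    have hy : r i ^ ringExpChar Ω ^ ν i ∈ K := by rw [hexp, hr i]; exact hB i
    have h := exists_mem_valuation_sub_lt_of_pow_mem V K hπK hπ0 hπ1 hy K.one_mem one_ne_zero
    rwa [map_one] at h
  choose β hβK hβ using hβ
  ---------------------------------------------------------------- Step 2: per-index congruence
  have hstep : ∀ i, 0 < i → ∃ d ∈ F, B.coeff i * zt ^ i - β i * zt ^ jj i = d ^ p - d := by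
    intro i hi
    have hy : β i * zt ^ jj i ∈ F := mul_mem (hKF (hβK i)) (pow_mem hztF _)
    have hpow : (zt ^ jj i) ^ p ^ ν i = zt ^ i := by rw [← pow_mul, mul_comm, hdecomp i]
    -- `bᵢ − βᵢ^{p^ν} = (rᵢ − βᵢ)^{p^ν}` is small
    have hsmall : V.valuation ((B.coeff i - β i ^ p ^ ν i) * zt ^ i) < 1 := by
      have h1 : B.coeff i - β i ^ p ^ ν i = (r i - β i) ^ p ^ ν i := by
        rw [sub_pow_char_pow, hr i]
      rw [map_mul, h1, map_pow]
      calc V.valuation (r i - β i) ^ p ^ ν i * V.valuation (zt ^ i)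
          ≤ V.valuation (r i - β i) ^ p ^ ν i * 1 := by gcongr; exact hztpow i
        _ < 1 := by
          rw [mul_one]
          exact pow_lt_one₀ zero_le (hβ i) (pow_ne_zero _ hp.ne_zero)
    have hmF : (B.coeff i - β i ^ p ^ ν i) * zt ^ i ∈ F :=
      mul_mem (sub_mem (hKF (hB i)) (pow_mem (hKF (hβK i)) _)) (pow_mem hztF _)
    obtain ⟨d₂, hd₂F, hd₂, -⟩ := exists_artinSchreierRoot_of_valuation_lt_one hF hmF hsmall
    obtain ⟨d₁, hd₁F, hd₁⟩ := exists_pow_sub_self_pow_pow_sub (p := p) hy (ν i)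
    have hsplit : B.coeff i * zt ^ i - β i * zt ^ jj i =
        ((β i * zt ^ jj i) ^ p ^ ν i - β i * zt ^ jj i) + (B.coeff i - β i ^ p ^ ν i) * zt ^ i := by
      rw [mul_pow, hpow]
      ring
    rw [hsplit]
    exact exists_pow_sub_self_add ⟨d₁, hd₁F, hd₁⟩ ⟨d₂, hd₂F, hd₂.symm⟩
  ---------------------------------------------------------------- Step 3: approximants `e_j ∈ K` of `S_j`
  set S : ℕ → Ω := fun j => pRootSum p B D j with hSdef
  have hSpow : ∀ j, S j ^ p ^ D ∈ K := by
    intro j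
    rw [hSdef]
    simp only
    rw [pRootSum_pow]
    exact sum_mem fun i _ => pow_mem (hB i) _
  have he : ∀ j, ∃ e ∈ K, (S j = 0 → e = 0) ∧ V.valuation (S j - e) < 1 ∧
      (S j ≠ 0 → V.valuation (S j - e) < V.valuation (S j)) := by
    intro j
    by_cases hS0 : S j = 0
    · refine ⟨0, K.zero_mem, fun _ => rfl, ?_, fun h => (h hS0).elim⟩
      rw [hS0, sub_zero, map_zero]
      exact zero_lt_one
    · -- an element `a ∈ K` with `v(a) = v(S_j)` (divisibility of `vK`), and a bound `b`
      have hSD0 : S j ^ p ^ D ≠ 0 := pow_ne_zero _ hS0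
      obtain ⟨a, haK, ha⟩ := exists_valuation_pow_eq_of_isSepClosed V (p ^ D)
        (pow_ne_zero _ hp.ne_zero) (hSpow j) hSD0
      have hva : V.valuation a = V.valuation (S j) := by
        rw [map_pow, map_pow] at ha
        exact pow_left_injective (pow_ne_zero _ hp.ne_zero) ha
      have ha0 : a ≠ 0 := by
        rintro rfl
        rw [map_zero, eq_comm, map_eq_zero] at hva
        exact hS0 hva
      -- the bound: `a` if `v(a) ≤ 1`, else `1`
      obtain ⟨b, hbK, hb0, hb1, hba⟩ : ∃ b ∈ K, b ≠ 0 ∧ V.valuation b ≤ 1 ∧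
          V.valuation b ≤ V.valuation (S j) := by
        by_cases hle : V.valuation a ≤ 1
        · exact ⟨a, haK, ha0, hle, hva.le⟩
        · push Not at hle
          exact ⟨1, K.one_mem, one_ne_zero, by rw [map_one], by rw [map_one, ← hva]; exact hle.le⟩
      have hy : S j ^ ringExpChar Ω ^ D ∈ K := by rw [hexp]; exact hSpow j
      obtain ⟨e, heK, he⟩ := exists_mem_valuation_sub_lt_of_pow_mem V K hπK hπ0 hπ1 hy hbK hb0
      exact ⟨e, heK, fun h => (hS0 h).elim, lt_of_lt_of_le he hb1, fun _ => lt_of_lt_of_le he hba⟩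
  choose e heK he0 he1 he2 using he
  ---------------------------------------------------------------- Step 4: the polynomial `g`
  set J : Finset ℕ := pFreeIndices p D with hJdef
  set P : Finset ℕ := posIndices D with hPdef
  set g : Polynomial Ω := C (B.coeff 0) + ∑ j ∈ J, C (e j) * X ^ j with hgdef
  have hgcoeff : ∀ n, g.coeff n = (if n = 0 then B.coeff 0 else 0) + (if n ∈ J then e n else 0) := by
    intro n
    rw [hgdef, coeff_add, coeff_C, finsetSum_coeff]
    congr 1
    have h1 : ∀ j ∈ J, (C (e j) * X ^ j).coeff n = if n = j then e j else 0 := by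
      intro j _
      rw [coeff_C_mul, coeff_X_pow, mul_ite, mul_one, mul_zero]
    rw [Finset.sum_congr rfl h1, Finset.sum_ite_eq]
  have h0J : (0 : ℕ) ∉ J := fun h => by
    have := (mem_pFreeIndices_iff.mp h).1.1
    exact lt_irrefl 0 this
  have hg0 : g.coeff 0 = B.coeff 0 := by
    rw [hgcoeff, if_pos rfl, if_neg h0J, add_zero]
  have hgJ : ∀ j ∈ J, g.coeff j = e j := by
    intro j hj
    have hj0 : j ≠ 0 := (mem_pFreeIndices_iff.mp hj).1.1.ne'
    rw [hgcoeff, if_neg hj0, if_pos hj, zero_add]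
  have hgnotJ : ∀ n, n ≠ 0 → n ∉ J → g.coeff n = 0 := by
    intro n hn hnJ
    rw [hgcoeff, if_neg hn, if_neg hnJ, add_zero]
  refine ⟨g, ?_, hg0, ?_, ?_, ?_⟩
  · -- coefficients in `K`
    intro n
    rw [hgcoeff]
    refine add_mem ?_ ?_
    · split_ifs
      · exact hB 0
      · exact K.zero_mem
    · split_ifs
      · exact heK n
      · exact K.zero_mem
  · ---------------------------------------------------------------- Step 5: the congruence
    -- `B(z̃) = b₀ + ∑_{i ∈ P} bᵢ z̃^i`, `g(z̃) = b₀ + ∑_{j ∈ J} e_j z̃^j`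
    have hBeval : B.eval zt = B.coeff 0 + ∑ i ∈ P, B.coeff i * zt ^ i := by
      rw [eval_eq_sum_range' (lt_of_le_of_lt hD (Nat.lt_succ_self D)), hPdef]
      unfold posIndices
      rw [← Finset.sum_filter_add_sum_filter_not (Finset.range (D + 1)) (fun i => 0 < i), add_comm]
      congr 1
      have hflt : (Finset.range (D + 1)).filter (fun i => ¬ 0 < i) = {0} := by
        ext i
        simp only [Finset.mem_filter, Finset.mem_range, Finset.mem_singleton, not_lt,
          Nat.le_zero]
        omega
      rw [hflt, Finset.sum_singleton, pow_zero, mul_one]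
    have hgeval : g.eval zt = B.coeff 0 + ∑ j ∈ J, e j * zt ^ j := by
      rw [hgdef, eval_add, eval_C, eval_finsetSum]
      congr 1
      refine Finset.sum_congr rfl fun j _ => ?_
      rw [eval_mul, eval_C, eval_pow, eval_X]
    -- collect the `βᵢ` along the fibres
    have hmaps : ∀ i ∈ P, jj i ∈ J := fun i hi => pFreePart_mem_pFreeIndices hp hi
    have hfib : ∑ i ∈ P, β i * zt ^ jj i = ∑ j ∈ J, (∑ i ∈ pFiber p D j, β i) * zt ^ j := by
      rw [← Finset.sum_fiberwise_of_maps_to hmaps]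
      refine Finset.sum_congr rfl fun j _ => ?_
      rw [Finset.sum_mul]
      refine Finset.sum_congr rfl fun i hi => ?_
      have hij : jj i = j := (Finset.mem_filter.mp hi).2
      rw [hij]
    have hident : B.eval zt - g.eval zt =
        ∑ i ∈ P, (B.coeff i * zt ^ i - β i * zt ^ jj i) +
          ∑ j ∈ J, ((∑ i ∈ pFiber p D j, β i) - e j) * zt ^ j := by
      have h2 : ∑ j ∈ J, ((∑ i ∈ pFiber p D j, β i) - e j) * zt ^ j =
          ∑ j ∈ J, (∑ i ∈ pFiber p D j, β i) * zt ^ j - ∑ j ∈ J, e j * zt ^ j := by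
        rw [← Finset.sum_sub_distrib]
        exact Finset.sum_congr rfl fun j _ => by ring
      rw [h2, Finset.sum_sub_distrib, hfib, hBeval, hgeval]
      ring
    rw [hident]
    refine exists_pow_sub_self_add (exists_pow_sub_self_sum P _ fun i hi => ?_)
      (exists_pow_sub_self_sum J _ fun j hj => ?_)
    · exact hstep i (mem_posIndices_iff.mp hi).1
    · -- `(∑_{fibre} βᵢ − e_j) z̃^j ∈ 𝓜_F ⊆ ℘(F)`
      have hmF : ((∑ i ∈ pFiber p D j, β i) - e j) * zt ^ j ∈ F :=
        mul_mem (sub_mem (sum_mem fun i _ => hKF (hβK i)) (hKF (heK j))) (pow_mem hztF _)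
      have hsmall : V.valuation (((∑ i ∈ pFiber p D j, β i) - e j) * zt ^ j) < 1 := by
        have hsplit : (∑ i ∈ pFiber p D j, β i) - e j =
            ∑ i ∈ pFiber p D j, (β i - r i) + (S j - e j) := by
          rw [Finset.sum_sub_distrib, hSdef]
          unfold pRootSum
          ring
        rw [map_mul]
        calc V.valuation ((∑ i ∈ pFiber p D j, β i) - e j) * V.valuation (zt ^ j)
            ≤ V.valuation ((∑ i ∈ pFiber p D j, β i) - e j) * 1 := by gcongr; exact hztpow j
          _ < 1 := by
            rw [mul_one, hsplit]
            refine lt_of_le_of_lt (V.valuation.map_add _ _) (max_lt ?_ (he1 j))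
            refine V.valuation.map_sum_lt one_ne_zero fun i _ => ?_
            rw [Valuation.map_sub_swap]
            exact hβ i
      obtain ⟨d, hdF, hd, -⟩ := exists_artinSchreierRoot_of_valuation_lt_one hF hmF hsmall
      exact ⟨d, hdF, hd.symm⟩
  · -- no positive index divisible by `p`
    intro i hi hpi
    refine hgnotJ i hi.ne' fun hiJ => ?_
    exact (mem_pFreeIndices_iff.mp hiJ).2 hpi
  · ---------------------------------------------------------------- Step 6: the values
    intro j hj hpj
    by_cases hjD : j ≤ D
    · have hjJ : j ∈ J := mem_pFreeIndices_iff.mpr ⟨⟨hj, hjD⟩, hpj⟩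
      rw [hgJ j hjJ]
      refine ⟨he0 j, fun hS0 => ?_⟩
      have h1 : e j = S j + -(S j - e j) := by ring
      have hlt : V.valuation (-(S j - e j)) < V.valuation (S j) := by
        rw [Valuation.map_neg]
        exact he2 j hS0
      rw [h1, V.valuation.map_add_eq_of_lt_left hlt]
    · push Not at hjD
      have hS0 : pRootSum p B D j = 0 := pRootSum_eq_zero_of_lt hjD
      have hjJ : j ∉ J := fun h => by
        have := (mem_pFreeIndices_iff.mp h).1.2
        omega
      refine ⟨fun _ => hgnotJ j hj.ne' hjJ, fun h => (h hS0).elim⟩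

end Elimination

end Literature.AlgebraicGeometry.Resolution

end
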